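import Summits.CriticalPhenomena.PercolationContinuityZ3.Theorems.PercNearOneGluingNoHeavyLowerTailSahiOneStepFreeExtension
import HarnessLib

/-!
# One-step scheme: the PIVOT IDENTITY for the quantitative-Harris functional `m′` along an ARBITRARY coordinate, and the easy cases of Q-HARRIS

Support file (prover prim-ineq-prove-3 gen 15; `--supports stmt-CriticalPhenomena-4575`; memo
`run/shared/lean/prim/prim-ineq-prove-3/FINDING-G15-TH2-KERNEL.md` §5.2–5.5).  No definitions, no named facts, no sorries, no `native_decide`.

`m′(H;A,B) = osMp p H (ind A) (ind B) = (1+μH)μ(HAB) − μ(H)μ(AB) − μ(HA)μ(HB) = Cov(1_{HA},1_{HB}) − μ(H)μ(AB∖H)`; "Q-HARRIS" is the conjecture `m′ ≥ 0` for all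
increasing `H, A, B` (product measures).  Sections at a coordinate `e`: `X¹ = {ω | insert e ω ∈ X}`, `X⁰ = {ω | ω ∖ {e} ∈ X}`.
* `osMp_ind_ind_pivot_eq` — for EVERY coordinate `e` (no hypothesis on `H, A, B`):
  `m′(H;A,B) = p_e·m′(H¹;A¹,B¹) + (1−p_e)·m′(H⁰;A⁰,B⁰) + p_e(1−p_e)·β_e`,
  `β_e = (μ(H¹A¹)−μ(H⁰A⁰))(μ(H¹B¹)−μ(H⁰B⁰)) + (μH¹−μH⁰)·[(μ(A¹B¹)−μ(A⁰B⁰)) − (μ(H¹A¹B¹)−μ(H⁰A⁰B⁰))]`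
  (`= d_{HA}d_{HB} + d_H·d_{AB∖H}` in terms of influences).  `…FreeExtension.osMp_ind_ind_free_split` is the case `H¹ = H⁰`, `…BlockReduction` the case `{e} ∈ A ∩ B`.
* `osMp_ind_ind_nonneg_of_pivot` — the inductive step: `m′ ≥ 0` on both section triples and `β_e ≥ 0` give `m′ ≥ 0` (CONJECTURE PIVOT of the memo: a
  coordinate with `β_e ≥ 0` always exists; census n = 4 exhaustive 3.8·10⁷, n = 5 9.7·10⁷ instances, 0 failures).
* `osMp_ind_ind_nonneg_of_subset`, `osMp_ind_ind_self_nonneg` — Q-HARRIS for NESTED pairs `A ⊆ B` and on the diagonal (Harris only), every increasing `H`.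
-/

noncomputable section

namespace Summit.CriticalPhenomena.PercolationContinuityZ3.Theorems

namespace SahiOneStep

open MeasureTheory
open Literature.Probability.Percolation (DeterminedBy determinedBy_iff determinedBy_univ)
open Literature.Probability.LatticeModels (prodBernoulli sahiE3 prodBernoulli_harris)
open Literature.Probability.Percolation.DecisionTree (ind)
open scoped Classical

variable {ι : Type*} [Fintype ι]

/-- **PIVOT IDENTITY for `m′` along an arbitrary coordinate `e`.** [this work] -/
theorem osMp_ind_ind_pivot_eq (p : ι → unitInterval) (H A B : Set (Set ι)) (e : ι) :
    osMp p H (ind A) (ind B) =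
      (p e : ℝ) * osMp p {ω : Set ι | insert e ω ∈ H} (ind {ω : Set ι | insert e ω ∈ A}) (ind {ω : Set ι | insert e ω ∈ B})
        + (1 - p e) * osMp p {ω : Set ι | ω \ {e} ∈ H} (ind {ω : Set ι | ω \ {e} ∈ A}) (ind {ω : Set ι | ω \ {e} ∈ B})
        + (p e : ℝ) * (1 - p e) *
          (((prodBernoulli p).real ({ω : Set ι | insert e ω ∈ H} ∩ {ω : Set ι | insert e ω ∈ A})
              - (prodBernoulli p).real ({ω : Set ι | ω \ {e} ∈ H} ∩ {ω : Set ι | ω \ {e} ∈ A})) *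
            ((prodBernoulli p).real ({ω : Set ι | insert e ω ∈ H} ∩ {ω : Set ι | insert e ω ∈ B})
              - (prodBernoulli p).real ({ω : Set ι | ω \ {e} ∈ H} ∩ {ω : Set ι | ω \ {e} ∈ B}))
          + ((prodBernoulli p).real {ω : Set ι | insert e ω ∈ H} - (prodBernoulli p).real {ω : Set ι | ω \ {e} ∈ H}) *
            (((prodBernoulli p).real ({ω : Set ι | insert e ω ∈ A} ∩ {ω : Set ι | insert e ω ∈ B})
                - (prodBernoulli p).real ({ω : Set ι | ω \ {e} ∈ A} ∩ {ω : Set ι | ω \ {e} ∈ B}))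
              - ((prodBernoulli p).real ({ω : Set ι | insert e ω ∈ H} ∩ {ω : Set ι | insert e ω ∈ A} ∩ {ω : Set ι | insert e ω ∈ B})
                - (prodBernoulli p).real ({ω : Set ι | ω \ {e} ∈ H} ∩ {ω : Set ι | ω \ {e} ∈ A} ∩ {ω : Set ι | ω \ {e} ∈ B})))) := by
  have eH := real_split p e H
  have eHA : (prodBernoulli p).real (H ∩ A) =
      (p e : ℝ) * (prodBernoulli p).real ({ω : Set ι | insert e ω ∈ H} ∩ {ω : Set ι | insert e ω ∈ A}) +
        (1 - p e) * (prodBernoulli p).real ({ω : Set ι | ω \ {e} ∈ H} ∩ {ω : Set ι | ω \ {e} ∈ A}) := by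
    rw [real_split p e (H ∩ A), section_insert_inter, section_sdiff_inter]
  have eHB : (prodBernoulli p).real (H ∩ B) =
      (p e : ℝ) * (prodBernoulli p).real ({ω : Set ι | insert e ω ∈ H} ∩ {ω : Set ι | insert e ω ∈ B}) +
        (1 - p e) * (prodBernoulli p).real ({ω : Set ι | ω \ {e} ∈ H} ∩ {ω : Set ι | ω \ {e} ∈ B}) := by
    rw [real_split p e (H ∩ B), section_insert_inter, section_sdiff_inter]
  have eAB : (prodBernoulli p).real (A ∩ B) =
      (p e : ℝ) * (prodBernoulli p).real ({ω : Set ι | insert e ω ∈ A} ∩ {ω : Set ι | insert e ω ∈ B}) +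
        (1 - p e) * (prodBernoulli p).real ({ω : Set ι | ω \ {e} ∈ A} ∩ {ω : Set ι | ω \ {e} ∈ B}) := by
    rw [real_split p e (A ∩ B), section_insert_inter, section_sdiff_inter]
  have eHAB : (prodBernoulli p).real (H ∩ A ∩ B) =
      (p e : ℝ) * (prodBernoulli p).real ({ω : Set ι | insert e ω ∈ H} ∩ {ω : Set ι | insert e ω ∈ A} ∩ {ω : Set ι | insert e ω ∈ B}) +
        (1 - p e) * (prodBernoulli p).real ({ω : Set ι | ω \ {e} ∈ H} ∩ {ω : Set ι | ω \ {e} ∈ A} ∩ {ω : Set ι | ω \ {e} ∈ B}) := by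
    rw [real_split p e (H ∩ A ∩ B), section_insert_inter, section_sdiff_inter, section_insert_inter, section_sdiff_inter]
  rw [osMp_ind_ind, osMp_ind_ind, osMp_ind_ind, eH, eHA, eHB, eAB, eHAB]
  ring

/-- **The inductive step of the pivot route to Q-HARRIS**: if `m′ ≥ 0` for both section triples at `e` and the bracket `β_e ≥ 0`, then `m′ ≥ 0`. [this work] -/
theorem osMp_ind_ind_nonneg_of_pivot (p : ι → unitInterval) (H A B : Set (Set ι)) (e : ι)
    (h1 : 0 ≤ osMp p {ω : Set ι | insert e ω ∈ H} (ind {ω : Set ι | insert e ω ∈ A}) (ind {ω : Set ι | insert e ω ∈ B}))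
    (h0 : 0 ≤ osMp p {ω : Set ι | ω \ {e} ∈ H} (ind {ω : Set ι | ω \ {e} ∈ A}) (ind {ω : Set ι | ω \ {e} ∈ B}))
    (hβ : 0 ≤ ((prodBernoulli p).real ({ω : Set ι | insert e ω ∈ H} ∩ {ω : Set ι | insert e ω ∈ A})
              - (prodBernoulli p).real ({ω : Set ι | ω \ {e} ∈ H} ∩ {ω : Set ι | ω \ {e} ∈ A})) *
            ((prodBernoulli p).real ({ω : Set ι | insert e ω ∈ H} ∩ {ω : Set ι | insert e ω ∈ B})
              - (prodBernoulli p).real ({ω : Set ι | ω \ {e} ∈ H} ∩ {ω : Set ι | ω \ {e} ∈ B}))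
          + ((prodBernoulli p).real {ω : Set ι | insert e ω ∈ H} - (prodBernoulli p).real {ω : Set ι | ω \ {e} ∈ H}) *
            (((prodBernoulli p).real ({ω : Set ι | insert e ω ∈ A} ∩ {ω : Set ι | insert e ω ∈ B})
                - (prodBernoulli p).real ({ω : Set ι | ω \ {e} ∈ A} ∩ {ω : Set ι | ω \ {e} ∈ B}))
              - ((prodBernoulli p).real ({ω : Set ι | insert e ω ∈ H} ∩ {ω : Set ι | insert e ω ∈ A} ∩ {ω : Set ι | insert e ω ∈ B})
                - (prodBernoulli p).real ({ω : Set ι | ω \ {e} ∈ H} ∩ {ω : Set ι | ω \ {e} ∈ A} ∩ {ω : Set ι | ω \ {e} ∈ B})))) :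
    0 ≤ osMp p H (ind A) (ind B) := by
  rw [osMp_ind_ind_pivot_eq p H A B e]
  have hp0 : 0 ≤ (p e : ℝ) := (p e).2.1
  have hq0 : 0 ≤ 1 - (p e : ℝ) := sub_nonneg.2 (p e).2.2
  have t1 := mul_nonneg hp0 h1
  have t2 := mul_nonneg hq0 h0
  have t3 := mul_nonneg (mul_nonneg hp0 hq0) hβ
  linarith

/-! ## The easy cases of Q-HARRIS: nested pairs and the diagonal (every increasing `H`) -/

/-- **Q-HARRIS for nested pairs.**  For increasing `H, A` and `A ⊆ B`: `m′(H;A,B) ≥ 0` — indeed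
`m′ = μ(HA)(1 + μH − μ(HB)) − μ(H)μ(A) ≥ μ(HA) − μ(H)μ(A) ≥ 0` (Harris). [this work] -/
theorem osMp_ind_ind_nonneg_of_subset (p : ι → unitInterval) {H A B : Set (Set ι)} (hH : IsUpperSet H) (hA : IsUpperSet A)
    (hAB : A ⊆ B) : 0 ≤ osMp p H (ind A) (ind B) := by
  rw [osMp_ind_ind]
  have hABe : A ∩ B = A := Set.inter_eq_left.2 hAB
  have hHABe : H ∩ A ∩ B = H ∩ A := by rw [Set.inter_assoc, hABe]
  rw [hABe, hHABe]
  have harris : (prodBernoulli p).real H * (prodBernoulli p).real A ≤ (prodBernoulli p).real (H ∩ A) :=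
    prodBernoulli_harris p hH hA MeasurableSet.of_discrete MeasurableSet.of_discrete
  have hHB : (prodBernoulli p).real (H ∩ B) ≤ (prodBernoulli p).real H := measureReal_mono Set.inter_subset_left
  have n1 : 0 ≤ (prodBernoulli p).real (H ∩ A) := measureReal_nonneg
  nlinarith [mul_nonneg n1 (sub_nonneg.2 hHB)]

/-- **Q-HARRIS on the diagonal `A = B`** (every increasing `H, A`): `(1+μH)μ(HA) ≥ μ(H)μ(A) + μ(HA)²`. [this work] -/
theorem osMp_ind_ind_self_nonneg (p : ι → unitInterval) {H A : Set (Set ι)} (hH : IsUpperSet H) (hA : IsUpperSet A) :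
    0 ≤ osMp p H (ind A) (ind A) :=
  osMp_ind_ind_nonneg_of_subset p hH hA subset_rfl

end SahiOneStep

end Summit.CriticalPhenomena.PercolationContinuityZ3.Theorems
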